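import Summits.CriticalPhenomena.PercolationContinuityZ3.Theorems.Transplant.FKThreeApexAlgebra
import HarnessLib

/-!
# The three-apex algebra extended by RIM STEPS: the boundary-moving operator of DOUBLE FANS, and the valid cone it preserves

Helper file (`--supports stmt-CriticalPhenomena-4575`), FK sub-lane `prim-bschramm-fk-3` (gen 20); builds on p205010 (kernel theorem,
internal audit signed; external expert review pending).  Pure real algebra: no measures, no named facts, no sorries; standard axioms.
Memo `bschramm/prim-bschramm-fk-3/DOUBLE-FAN.md`.

The three-apex monoid (`…ThreeApexAlgebra`) describes every graph glued from leaves and triangle edges on a FIXED boundary triple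
`{a, b, c}`.  A DOUBLE FAN `K₂ ∨ P_n` (apices `a = N`, `b = S`; rim path `c_1 … c_n`; spokes `N c_i`, `S c_i`; axis `N S`) — and more
generally every graph obtained by hanging three-apex words on the consecutive triples `{N, S, c_i}` — is read by the SAME five-state
transfer over the partition lattice `Π₃` of the moving boundary `{N, S, c_i}`, with exactly one new operation: the **rim step**
`E_r` (a new rim vertex `c'` joined to the current `c` by an edge of probability `r`, after which `c` leaves the boundary and `c'` takes
its place).  On fibre-mass vectors `Z = (Z_0, Z_ab, Z_ac, Z_bc, Z_1)`:
* `detach q Z = (q Z_0 + Z_ac + Z_bc, q Z_ab + Z_1, 0, 0, 0)` (`r = 0`: the old `c` is summed out — a factor `q` when it was a singleton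
  block — and the fresh `c'` is isolated), a non-negative multiple of an `ab`-edge letter;
* `rimStep q r Z = r • Z + (1 − r) • detach q Z` (with probability `r` the new vertex joins the block of the old one).
Main content: the package of valid inequalities of the monoid that SURVIVES rim steps and products —
`Valid q Z` := masses `≥ 0`, the three master forms `N^{(ac)}, N^{(ab)}, N^{(bc)} ≥ 0`, the lower envelope `Λ ≥ 0`, and the three
`κ`-forms `≥ 0` — with the exact identities `masterN_rimStep` (`N^{(ac)}(E_r Z) = r(r + (1−r)q)·N^{(ac)}(Z)`), `masterNbc_rimStep`,
`masterNab_rimStep`, `lam_rimStep`, `kap_rimStep`, `kapB_rimStep`, `kapC_rimStep`, `kap_conv`; hence (`InKE`, the closure of `δ_0` under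
letters, rim steps and products) **`InKE.valid`**, and the first pair types of double fans at the algebra level: `InKE.t1Form_nonneg`
(two leaf edges at a leaf hanging on any triple `{N,S,c_i}`) and the master forms themselves (two spokes `N c_i, S c_i` at one rim vertex;
axis against a spoke), for rests that are arbitrary elements of `InKE` (prefix ∗ reversed suffix of the double fan).
NOT here (memo §4–§6): the caps and the harmonic cap of `…ThreeApexCap/HarmCap` are NOT preserved by rim steps (exact counterexamples),
so type T3 does not transfer by that route; the cross-block pair types need the frame calculus of the memo.
[cite: Grimmett2006, §3.9 eq. (3.94) (pp. 63–64)] [cite: Wagner2006, Conj. 5.3, Thm. 5.8 (pp. 13–15)] [folklore]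
-/

noncomputable section

namespace Summit.CriticalPhenomena.PercolationContinuityZ3.Theorems

namespace FK

namespace ThreeApex

/-! ### The rim-step operators -/

/-- **Detach `c`.**  The old boundary vertex `c` is summed out (a factor `q` exactly when it was a singleton block) and a fresh isolated
vertex takes its name: `(Z_0, Z_ab, Z_ac, Z_bc, Z_1) ↦ (q Z_0 + Z_ac + Z_bc, q Z_ab + Z_1, 0, 0, 0)`. [folklore] -/
def detach (q : ℝ) (Z : V5) : V5 := ⟨q * Z.z0 + Z.zac + Z.zbc, q * Z.zab + Z.z1, 0, 0, 0⟩

/-- **Rim step** with rim-edge probability `r`: `E_r Z = r Z + (1 − r)·detach Z` (the new rim vertex joins the block of the old one with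
probability `r`, otherwise the old one is detached). [folklore] -/
def rimStep (q r : ℝ) (Z : V5) : V5 :=
  ⟨r * Z.z0 + (1 - r) * (q * Z.z0 + Z.zac + Z.zbc), r * Z.zab + (1 - r) * (q * Z.zab + Z.z1), r * Z.zac, r * Z.zbc, r * Z.z1⟩

/-- `E_1 = id`. [folklore] -/
theorem rimStep_one (q : ℝ) (Z : V5) : rimStep q 1 Z = Z := by
  ext <;> simp [rimStep]

/-- `E_0 = detach`. [folklore] -/
theorem rimStep_zero (q : ℝ) (Z : V5) : rimStep q 0 Z = detach q Z := by
  ext <;> simp [rimStep, detach]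

/-- The detached vector is the `ab`-edge letter of probability `w` scaled by `t`, whenever `t·(1−w)` and `t·w` are its two masses:
`detach q Z = (t(1−w), t w, 0, 0, 0)`.  (So `detach` maps the non-negative cone into non-negative multiples of letters.) [folklore] -/
theorem detach_eq_smul_edgeAB (q : ℝ) (Z : V5) {t w : ℝ} (h0 : t * (1 - w) = q * Z.z0 + Z.zac + Z.zbc) (h1 : t * w = q * Z.zab + Z.z1) :
    detach q Z = ⟨t * (edgeAB w).z0, t * (edgeAB w).zab, t * (edgeAB w).zac, t * (edgeAB w).zbc, t * (edgeAB w).z1⟩ := by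
  ext <;> simp [detach, edgeAB, h0, h1]

/-- The axis letter commutes with detaching `c`. [folklore] -/
theorem detach_conv_edgeAB (q w : ℝ) (Z : V5) : detach q (conv (edgeAB w) Z) = conv (edgeAB w) (detach q Z) := by
  ext <;> simp only [detach, conv, edgeAB, V5.total] <;> ring

/-- The axis letter commutes with the rim step. [folklore] -/
theorem rimStep_conv_edgeAB (q r w : ℝ) (Z : V5) : rimStep q r (conv (edgeAB w) Z) = conv (edgeAB w) (rimStep q r Z) := by
  ext <;> simp only [rimStep, conv, edgeAB, V5.total] <;> ring

/-- The rim step commutes with the relabelling `a ↔ b`. [folklore] -/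
theorem swapAB_rimStep (q r : ℝ) (Z : V5) : swapAB (rimStep q r Z) = rimStep q r (swapAB Z) := by
  have e : q * Z.z0 + Z.zac + Z.zbc = q * Z.z0 + Z.zbc + Z.zac := by ring
  ext <;> simp only [rimStep, swapAB, e]

/-- Total mass after a rim step: `|E_r Z| = r|Z| + (1−r)(|Z| − (1−q)(Z_0 + Z_ab))`. [folklore] -/
theorem total_rimStep (q r : ℝ) (Z : V5) :
    (rimStep q r Z).total = r * Z.total + (1 - r) * (Z.total - (1 - q) * (Z.z0 + Z.zab)) := by
  simp only [rimStep, V5.total]; ring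

/-! ### Exact rim-step identities for the valid forms -/

/-- `N^{(ac)}(E_r Z) = r (r + (1−r) q) · N^{(ac)}(Z)`. [folklore] -/
theorem masterN_rimStep (q r : ℝ) (Z : V5) : masterN q (rimStep q r Z) = r * (r + (1 - r) * q) * masterN q Z := by
  simp only [masterN, rimStep]; ring

/-- `N^{(bc)}(E_r Z) = r (r + (1−r) q) · N^{(bc)}(Z)`. [folklore] -/
theorem masterNbc_rimStep (q r : ℝ) (Z : V5) :
    masterN q (swapAB (rimStep q r Z)) = r * (r + (1 - r) * q) * masterN q (swapAB Z) := by
  simp only [masterN, rimStep, swapAB]; ring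

/-- `N^{(ab)}(E_r Z) = r² N^{(ab)}(Z) + r(1−r)·M + (1−r)²·N^{(ab)}(detach Z)` with `M` and the last term polynomials with
non-negative coefficients in the masses. [folklore] -/
theorem masterNab_rimStep (q r : ℝ) (Z : V5) :
    masterN q (swapBC (rimStep q r Z)) = r ^ 2 * masterN q (swapBC Z)
      + r * (1 - r) * (q ^ 2 * Z.z0 * Z.z1 + 2 * q ^ 2 * Z.z0 * Z.zab + q * Z.zbc * Z.z1 + q * Z.zac * Z.z1 + q * Z.zab * Z.z1
          + 2 * q * Z.zab * Z.zbc + 2 * q * Z.zab * Z.zac + 2 * q * Z.zab ^ 2 + Z.z1 ^ 2 + 2 * Z.zab * Z.z1)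
      + (1 - r) ^ 2 * (q ^ 3 * Z.z0 * Z.zab + q ^ 2 * Z.zab * Z.zbc + q ^ 2 * Z.zab * Z.zac + q ^ 2 * Z.zab ^ 2 + q ^ 2 * Z.z0 * Z.z1
          + q * Z.zbc * Z.z1 + q * Z.zac * Z.z1 + 2 * q * Z.zab * Z.z1 + Z.z1 ^ 2) := by
  simp only [masterN, rimStep, swapBC]; ring

/-- `Λ(E_r Z) = r (r + (1−r) q) Λ(Z) + q r (1−r) Z_ac Z_bc`. [folklore] -/
theorem lam_rimStep (q r : ℝ) (Z : V5) : lam (rimStep q r Z) = r * (r + (1 - r) * q) * lam Z + q * r * (1 - r) * (Z.zac * Z.zbc) := by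
  simp only [lam, rimStep]; ring

/-- `κ(E_r Z) = r² κ(Z) + r(1−r)·(N^{(ac)}(Z) + Λ(Z) + Z_ac Z_bc)`. [folklore] -/
theorem kap_rimStep (q r : ℝ) (Z : V5) :
    kap (rimStep q r Z) = r ^ 2 * kap Z + r * (1 - r) * (masterN q Z + lam Z + Z.zac * Z.zbc) := by
  simp only [kap, rimStep, masterN, lam]; ring

/-- The `κ`-form with middle block `ab` after a rim step: `r² κ_ab(Z) +` polynomials with non-negative coefficients. [folklore] -/
theorem kapB_rimStep (q r : ℝ) (Z : V5) :
    kap (swapBC (rimStep q r Z)) = r ^ 2 * kap (swapBC Z)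
      + r * (1 - r) * (q * Z.z0 * Z.z1 + 2 * q * Z.z0 * Z.zab + Z.zbc * Z.z1 + Z.zac * Z.z1 + Z.zab * Z.zbc + Z.zab * Z.zac + Z.z0 * Z.z1)
      + (1 - r) ^ 2 * (q ^ 2 * Z.z0 * Z.zab + q * Z.zab * Z.zbc + q * Z.zab * Z.zac + q * Z.z0 * Z.z1 + Z.zbc * Z.z1 + Z.zac * Z.z1) := by
  simp only [kap, rimStep, swapBC]; ring

/-- The `κ`-form with middle block `bc` after a rim step: `r² κ_bc(Z) + r(1−r)(N^{(bc)}(Z) + Λ(Z) + Z_ac Z_bc)`. [folklore] -/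
theorem kapC_rimStep (q r : ℝ) (Z : V5) :
    kap (swapAB (rimStep q r Z)) = r ^ 2 * kap (swapAB Z) + r * (1 - r) * (masterN q (swapAB Z) + lam Z + Z.zac * Z.zbc) := by
  simp only [kap, rimStep, swapAB, masterN, lam]; ring

/-- **Product identity for `κ`** (in hat coordinates `κ = ûv̂ − x̂ẑ` is a difference of products):
`κ(M(z)Z) = κ(z)·Z_0|Z| + (z_0+z_ab)(z_0+z_bc)·κ(Z)`. [folklore] -/
theorem kap_conv (z Z : V5) :
    kap (conv z Z) = kap z * (Z.z0 * Z.total) + (z.z0 + z.zab) * (z.z0 + z.zbc) * kap Z := by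
  simp only [kap, conv, V5.total]; ring

/-! ### The valid cone -/

/-- The package of valid inequalities that survives letters, rim steps and products: non-negative masses, the three master forms,
the lower envelope and the three `κ`-forms. [folklore] -/
structure Valid (q : ℝ) (Z : V5) : Prop where
  /-- masses `≥ 0` -/
  nonneg : Z.Nonneg
  /-- `N^{(ac)}(Z) ≥ 0` -/
  nAC : 0 ≤ masterN q Z
  /-- `N^{(ab)}(Z) ≥ 0` -/
  nAB : 0 ≤ masterN q (swapBC Z)
  /-- `N^{(bc)}(Z) ≥ 0` -/
  nBC : 0 ≤ masterN q (swapAB Z)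
  /-- `Λ(Z) ≥ 0` -/
  lam : 0 ≤ ThreeApex.lam Z
  /-- `κ_ac(Z) ≥ 0` -/
  kapA : 0 ≤ kap Z
  /-- `κ_ab(Z) ≥ 0` -/
  kapB : 0 ≤ kap (swapBC Z)
  /-- `κ_bc(Z) ≥ 0` -/
  kapC : 0 ≤ kap (swapAB Z)

/-- `swapBC ∘ swapAB ∘ swapBC ∘ swapAB` bookkeeping: `swapAB (swapBC Z)` has `κ`/master forms among those of `Z`. [folklore] -/
theorem swapBC_swapBC (Z : V5) : swapBC (swapBC Z) = Z := by ext <;> rfl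

/-- `swapAB` is an involution. [folklore] -/
theorem swapAB_swapAB (Z : V5) : swapAB (swapAB Z) = Z := by ext <;> rfl

/-- `masterN` of `swapBC (swapAB Z)` is the `bc`-form of... expressed through the three package forms: it equals `N^{(bc)}` of `swapBC Z`,
i.e. the form with middle block `ab`?  Concretely `masterN q (swapAB (swapBC Z)) = masterN q (swapAB Z)` evaluated at... we only need the
two identities below. [folklore] -/
theorem masterN_swapAB_swapBC (q : ℝ) (Z : V5) :
    masterN q (swapAB (swapBC Z)) = Z.zbc * (q * Z.z0 + Z.zac + Z.zab + Z.zbc + Z.z1) + (1 - q) * (Z.zac * Z.zab - Z.z0 * Z.z1) := by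
  simp only [masterN, swapAB, swapBC]; ring

/-- The valid cone is invariant under `a ↔ b`. [folklore] -/
theorem Valid.swapAB {q : ℝ} {Z : V5} (h : Valid q Z) : Valid q (ThreeApex.swapAB Z) := by
  obtain ⟨⟨h0, h1, h2, h3, h4⟩, nac, nab, nbc, hl, ka, kb, kc⟩ := h
  refine ⟨⟨h0, h1, h3, h2, h4⟩, nbc, ?_, ?_, ?_, kc, ?_, ?_⟩
  · have e : masterN q (ThreeApex.swapBC (ThreeApex.swapAB Z)) = masterN q (ThreeApex.swapBC Z) := by
      simp only [masterN, ThreeApex.swapBC, ThreeApex.swapAB]; ring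
    rw [e]; exact nab
  · rw [swapAB_swapAB]; exact nac
  · have e : ThreeApex.lam (ThreeApex.swapAB Z) = ThreeApex.lam Z := by simp only [ThreeApex.lam, ThreeApex.swapAB]; ring
    rw [e]; exact hl
  · have e : kap (ThreeApex.swapBC (ThreeApex.swapAB Z)) = kap (ThreeApex.swapBC Z) := by
      simp only [kap, ThreeApex.swapBC, ThreeApex.swapAB]; ring
    rw [e]; exact kb
  · rw [swapAB_swapAB]; exact ka

/-- The valid cone is invariant under `b ↔ c`. [folklore] -/
theorem Valid.swapBC {q : ℝ} {Z : V5} (h : Valid q Z) : Valid q (ThreeApex.swapBC Z) := by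
  obtain ⟨⟨h0, h1, h2, h3, h4⟩, nac, nab, nbc, hl, ka, kb, kc⟩ := h
  refine ⟨⟨h0, h2, h1, h3, h4⟩, nab, ?_, ?_, ?_, kb, ?_, ?_⟩
  · rw [swapBC_swapBC]; exact nac
  · have e : masterN q (ThreeApex.swapAB (ThreeApex.swapBC Z)) = masterN q (ThreeApex.swapAB Z) := by
      simp only [masterN, ThreeApex.swapBC, ThreeApex.swapAB]; ring
    rw [e]; exact nbc
  · have e : ThreeApex.lam (ThreeApex.swapBC Z) = ThreeApex.lam Z := by simp only [ThreeApex.lam, ThreeApex.swapBC]; ring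
    rw [e]; exact hl
  · rw [swapBC_swapBC]; exact ka
  · have e : kap (ThreeApex.swapAB (ThreeApex.swapBC Z)) = kap (ThreeApex.swapAB Z) := by
      simp only [kap, ThreeApex.swapBC, ThreeApex.swapAB]; ring
    rw [e]; exact kc

/-- `δ_0` is valid. [folklore] -/
theorem valid_delta0 (q : ℝ) : Valid q delta0 :=
  ⟨⟨by simp [delta0], by simp [delta0], by simp [delta0], by simp [delta0], by simp [delta0]⟩,
    by simp [masterN, delta0], by simp [masterN, swapBC, delta0], by simp [masterN, swapAB, delta0], by simp [lam, delta0],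
    by simp [kap, delta0], by simp [kap, swapBC, delta0], by simp [kap, swapAB, delta0]⟩

/-- Every letter is valid (`0 ≤ q ≤ 1`). [folklore] -/
theorem IsLetter.valid {q : ℝ} (hq0 : 0 ≤ q) (hq1 : q ≤ 1) {z : V5} (h : IsLetter q z) : Valid q z :=
  ⟨h.nonneg hq0, h.masterN_nonneg hq0 hq1, h.swapBC.masterN_nonneg hq0 hq1, h.swapAB.masterN_nonneg hq0 hq1, h.lam_nonneg hq0,
    h.kap_nonneg hq0, h.swapBC.kap_nonneg hq0, h.swapAB.kap_nonneg hq0⟩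

/-- One-sided product lemma: `N^{(ac)}(M(z)Z) ≥ 0` whenever `z` is valid-like (`N^{(ac)}, κ ≥ 0`, masses `≥ 0`) and `Z` has
`N^{(ac)} ≥ 0` and masses `≥ 0` (the master identity `masterN_conv`). [folklore] -/
theorem masterN_conv_nonneg {q : ℝ} (hq0 : 0 ≤ q) {z Z : V5} (hz : z.Nonneg) (hZ : Z.Nonneg) (gn : 0 ≤ masterN q z) (gk : 0 ≤ kap z)
    (hn : 0 ≤ masterN q Z) : 0 ≤ masterN q (conv z Z) := by
  obtain ⟨h0, h1, h2, h3, h4⟩ := hZ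
  obtain ⟨g0, g1, g2, g3, g4⟩ := hz
  have gt : 0 ≤ z.total := V5.Nonneg.total ⟨g0, g1, g2, g3, g4⟩
  rw [masterN_conv]
  positivity

/-- **The valid cone is a monoid**: closed under the letter action / product `conv`. [folklore] -/
theorem Valid.conv {q : ℝ} (hq0 : 0 ≤ q) {z Z : V5} (hz : Valid q z) (hZ : Valid q Z) : Valid q (ThreeApex.conv z Z) := by
  obtain ⟨h0, h1, h2, h3, h4⟩ := hZ.nonneg
  obtain ⟨g0, g1, g2, g3, g4⟩ := hz.nonneg
  have gt : 0 ≤ z.total := V5.Nonneg.total hz.nonneg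
  have ht : 0 ≤ Z.total := V5.Nonneg.total hZ.nonneg
  refine ⟨?_, ?_, ?_, ?_, ?_, ?_, ?_, ?_⟩
  · refine ⟨?_, ?_, ?_, ?_, ?_⟩ <;> simp only [ThreeApex.conv] <;> positivity
  · exact masterN_conv_nonneg hq0 hz.nonneg hZ.nonneg hz.nAC hz.kapA hZ.nAC
  · rw [swapBC_conv]; exact masterN_conv_nonneg hq0 hz.swapBC.nonneg hZ.swapBC.nonneg hz.nAB hz.kapB hZ.nAB
  · rw [swapAB_conv]; exact masterN_conv_nonneg hq0 hz.swapAB.nonneg hZ.swapAB.nonneg hz.nBC hz.kapC hZ.nBC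
  · have := hz.lam; have := hZ.lam
    rw [lam_conv]; positivity
  · have := hz.kapA; have := hZ.kapA
    rw [kap_conv]; positivity
  · have := hz.kapB; have := hZ.kapB
    obtain ⟨e0, e1, e2, e3, e4⟩ := hZ.swapBC.nonneg
    have et : 0 ≤ (ThreeApex.swapBC Z).total := V5.Nonneg.total ⟨e0, e1, e2, e3, e4⟩
    obtain ⟨f0, f1, f2, f3, f4⟩ := hz.swapBC.nonneg
    rw [swapBC_conv, kap_conv]; positivity
  · have := hz.kapC; have := hZ.kapC
    obtain ⟨e0, e1, e2, e3, e4⟩ := hZ.swapAB.nonneg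
    have et : 0 ≤ (ThreeApex.swapAB Z).total := V5.Nonneg.total ⟨e0, e1, e2, e3, e4⟩
    obtain ⟨f0, f1, f2, f3, f4⟩ := hz.swapAB.nonneg
    rw [swapAB_conv, kap_conv]; positivity

/-- **The valid cone is closed under rim steps** (`0 ≤ q ≤ 1`, `0 ≤ r ≤ 1`). [folklore] -/
theorem Valid.rimStep {q r : ℝ} (hq0 : 0 ≤ q) (hq1 : q ≤ 1) (hr0 : 0 ≤ r) (hr1 : r ≤ 1) {Z : V5} (h : Valid q Z) :
    Valid q (ThreeApex.rimStep q r Z) := by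
  obtain ⟨⟨h0, h1, h2, h3, h4⟩, nac, nab, nbc, hl, ka, kb, kc⟩ := h
  have hr' : 0 ≤ 1 - r := sub_nonneg.2 hr1
  have hq' : 0 ≤ 1 - q := sub_nonneg.2 hq1
  have hrho : 0 ≤ r + (1 - r) * q := by positivity
  refine ⟨?_, ?_, ?_, ?_, ?_, ?_, ?_, ?_⟩
  · refine ⟨?_, ?_, ?_, ?_, ?_⟩ <;> simp only [ThreeApex.rimStep] <;> positivity
  · rw [masterN_rimStep]; positivity
  · rw [masterNab_rimStep]; positivity
  · rw [masterNbc_rimStep]; positivity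
  · rw [lam_rimStep]; positivity
  · rw [kap_rimStep]; positivity
  · rw [kapB_rimStep]; positivity
  · rw [kapC_rimStep]; positivity

/-! ### The closure of the monoid under rim steps and products -/

/-- `InKE q`: fibre-mass vectors reachable from `δ_0` by letters, rim steps with `r ∈ [0,1]`, and products — the vectors of all gadgets
of the double-fan class (three-apex words hung on consecutive triples `{N,S,c_i}` of a rim path, glued along the current triple). [folklore] -/
inductive InKE (q : ℝ) : V5 → Prop
  | base : InKE q delta0
  | step {z Z : V5} : IsLetter q z → InKE q Z → InKE q (conv z Z)
  | rim {r : ℝ} {Z : V5} : 0 ≤ r → r ≤ 1 → InKE q Z → InKE q (rimStep q r Z)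
  | mul {Y Z : V5} : InKE q Y → InKE q Z → InKE q (conv Y Z)

/-- The three-apex monoid is contained in its rim-step closure. [folklore] -/
theorem InK.inKE {q : ℝ} {Z : V5} (h : InK q Z) : InKE q Z := by
  induction h with
  | base => exact InKE.base
  | step hz _ ih => exact InKE.step hz ih

/-- **Every vector of `InKE q` is valid** (`0 ≤ q ≤ 1`). [folklore] -/
theorem InKE.valid {q : ℝ} (hq0 : 0 ≤ q) (hq1 : q ≤ 1) {Z : V5} (h : InKE q Z) : Valid q Z := by
  induction h with
  | base => exact valid_delta0 q
  | step hz _ ih => exact (hz.valid hq0 hq1).conv hq0 ih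
  | rim hr0 hr1 _ ih => exact ih.rimStep hq0 hq1 hr0 hr1
  | mul _ _ ihY ihZ => exact ihY.conv hq0 ihZ

/-- `InKE q` is invariant under `a ↔ b` (the two apices of a double fan play symmetric roles). [folklore] -/
theorem InKE.swapAB {q : ℝ} {Z : V5} (h : InKE q Z) : InKE q (ThreeApex.swapAB Z) := by
  induction h with
  | base =>
    have e : ThreeApex.swapAB ThreeApex.delta0 = ThreeApex.delta0 := by ext <;> simp [ThreeApex.swapAB, ThreeApex.delta0]
    rw [e]; exact InKE.base
  | step hz _ ih => rw [swapAB_conv]; exact InKE.step hz.swapAB ih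
  | rim hr0 hr1 _ ih => rw [swapAB_rimStep]; exact InKE.rim hr0 hr1 ih
  | mul _ _ ihY ihZ => rw [swapAB_conv]; exact InKE.mul ihY ihZ

/-! ### First pair types of double fans at the algebra level -/

/-- **Two spokes at one rim vertex / the master forms on `InKE`.**  For every rest `Z ∈ InKE q` (`0 ≤ q ≤ 1`):
`N^{(ac)}(Z), N^{(ab)}(Z), N^{(bc)}(Z) ≥ 0` — the Rayleigh differences (up to the factor `q²(1−q)`) of the pairs of boundary edges
`{ab, bc}`, `{ac, bc}`, `{ab, ac}` against that rest; for a double fan: the two spokes `N c_i, S c_i` at a rim vertex, and the axis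
against a spoke, with the rest `=` prefix `∗` reversed suffix. [folklore] -/
theorem InKE.masterN_nonneg_all {q : ℝ} (hq0 : 0 ≤ q) (hq1 : q ≤ 1) {Z : V5} (h : InKE q Z) :
    0 ≤ masterN q Z ∧ 0 ≤ masterN q (ThreeApex.swapBC Z) ∧ 0 ≤ masterN q (ThreeApex.swapAB Z) :=
  ⟨(h.valid hq0 hq1).nAC, (h.valid hq0 hq1).nAB, (h.valid hq0 hq1).nBC⟩

/-- **Type T1 on `InKE`**: the two edges `u a, u b` of a leaf `u` hung on the current triple are negatively correlated for every rest in
`InKE q` (`0 ≤ q ≤ 1`, third leaf probability `c ∈ [0,1]`) — the T1 decomposition needs only `N^{(ab)} ≥ 0` and masses `≥ 0`. [folklore] -/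
theorem InKE.t1Form_nonneg {q c : ℝ} (hq0 : 0 ≤ q) (hq1 : q ≤ 1) (hc0 : 0 ≤ c) (hc1 : c ≤ 1) {Z : V5} (h : InKE q Z) :
    0 ≤ t1Form q c Z := by
  have hv := h.valid hq0 hq1
  obtain ⟨h0, h1, h2, h3, h4⟩ := hv.nonneg
  have hN : 0 ≤ masterN q (ThreeApex.swapBC Z) := hv.nAB
  have hq' : (0 : ℝ) ≤ 1 - q := sub_nonneg.2 hq1
  have hc' : (0 : ℝ) ≤ 1 - c := sub_nonneg.2 hc1
  have h2q : 0 ≤ 2 - q := by linarith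
  rw [t1_decomp]
  positivity

end ThreeApex

end FK

end Summit.CriticalPhenomena.PercolationContinuityZ3.Theorems
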